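import Summits.ABC.IUTFork.Joshi.ATS4DescentSpineGenuineResidualUnsatDegOne
import HarnessLib

/-!
# [J-IV] (arXiv:2403.10430v2) §6.10–§7.1, E5 descent spine, R-J row Y-21 PARENT small print (r2) — EFFECTIVITY of the `d = 1`
# countermodel: the witness `λ_k` is EXPLICIT in the ONE typed constant `B` (E-t29's Tate-threshold); Cor. 2.2 (i)'s `C` and
# the height bound `H` of the exceptional set are NOT needed (E ROWS #5, row R-35)

Proof-only companion (0 defs) of the abc-iut cell, sub-cell R-J «JOSHI Y-DISCHARGE CENSUS» (rung LADDER-ABC:A2.RESCUE.J), seat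
abc-iut-E-t59 (gen 11), row R-35 of `HOME/plan/E/R-J/E-ROWS.md` (#5): «Y-21 PARENT (r2) EFFECTIVITY: the ¬H₁ witness `k = max(10⁷, n)` is
ineffective through Exc's `H` / Cor 2.2 (i)'s `C` (lane-2 honest scope 02:45:43Z) — either give `k` as an explicit function of the typed constant
binder (kernel, over p488306's `LambdaSevenResidual`), or post LOCATED». DEFS-FREEZE: abc-iut-E-t35's p487789 / p488306
(`ATS4GenuineResidualLambdaSevenFibres`, `ATS4DescentSpineGenuineResidualUnsatDegOne`), abc-iut-E-t30's `ATS4Lem678Genuine` and abc-iut-E-t29's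
`ATS4VojtaInputsSupply` are imported and consumed BY NAME; nothing is restated.

WHAT p488306 DID. `not_genuineResidualSupport_antecedent_degOne` refutes the `d = 1` narrowing `H₁` of the antecedent of E-t33's
`abc_of_genuineResidualSupport` at the `ℚ`-point `λ_k = 1/2 + 2/7^k`, `k := max(10⁷, n)` with `n > 3(H + C)/log 7`, where `H` bounds the HEIGHT on the
exceptional set `Exc` of E-t30's supplier `exists_isLem587Prime_lem678Room_offExc` (`∃ Exc, (∃ H, ∀ P ∈ Exc, ht P ≤ H) ∧ …`) and `C` is the
BD-constant of [IUTchIV] Cor. 2.2 (i) (`Cor22.partI_holds`, `BDEquiv … .bdLe : ∃ C, …`) converting height back into `log q^∀`. Both are `∃`-bound,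
so that `k` is not a closed term — lane 2's honest scope (5).

WHAT THIS FILE SHOWS (kernel). The detour through heights is unnecessary: INSIDE E-t30's proof the exceptional set IS a TATE-THRESHOLD set
`{Tate(C_λ) ≤ T}`, `T = max(max B 12, (3·log(4·2¹²·3³·5·d))²)`, with `B = B(Z, d)` the threshold of abc-iut-E-t29's `exists_threshold_P1_to_P6`
(«every `C_λ ∈ Z ∩ U_{≤d}` with `Tate(C_λ) > B` carries a prime `ℓ ≥ 7` of Lemma 5.8.7 with (P5), (P6)»), and `Tate(λ_k) = log q^∀(λ_k) ≥ 2k·log 7`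
is explicit (`Cor22.two_mul_log_seven_le_logQForall_lam`). Hence:

* §1 `isLem587Prime_itd_core_room_of_tateThreshold` / `…_of_lt` — the supplier in THRESHOLD FORM, parametric in `B`, for every `Z`, `d`: above
  `max(max B 12, R_d²)` every point carries `ℓ` with `IsLem587Prime ∧ ITDConditions ∧ AdmitsCore ∧ room` — NO `Cor22.Hypotheses`, NO
  `Cor22.partI_holds`: the constant `C` of Cor. 2.2 (i) is ELIMINATED, and no exceptional-set height bound `H` occurs;
* §2 `LambdaSevenResidual.roomConst_sq_lt` (`(3·log 2211840)² < 2·10⁷·log 7`, so at `d = 1`, `k ≥ 10⁷` the `12`- and `R₁²`-clauses of `T` are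
  automatic) and `LambdaSevenResidual.supplied_at_lam`: on `K_V = CBData.std {2}`, `d = 1`, for EVERY `k ≥ 10⁷` with `B < 2k·log 7` the binder's
  conditions are MET at `λ_k` by some prime `ℓ ≥ 11`;
* §3 **`LambdaSevenResidual.not_antecedent_degOne_at_lam`** — the `∀ℓ`-clause of `H₁` AT THE POINT `λ_k` (VERBATIM, `P := λ_k`) is FALSE for every
  such `k` (E-t35's uniform `genuineResidualSupport_unsat` BY NAME), and **`…_at_lam_of_kZero_le`**: for every
  `k ≥ k₀(B) := max(10⁷, ⌊B/(2·log 7)⌋₊ + 1)` — `k₀` a CLOSED TERM in the one real parameter `B` (`kZero_spec`);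
* §4 LOCATION of the residual `∃`: `exists_tateThreshold_std_two_degOne` is E-t29's `exists_threshold_P1_to_P6` at (`CBData.std {2}`, `d = 1`); its
  `B = max(max B′ 49, max H_K ξ²)` is `∃`-bound through `lem589_holds` (`B′`, via the BD-constant of `Cor22.partI_first`), `Cor22.condP6_of_seven_le`
  (`H_K`, via `exists_jInv_bound` and the [GenEll] Lem. 3.5 / Prop. 3.4 constants `GenEll_lemma35_general` / `prop34Ineq_of_pos`) and
  `exists_isXiPrm` (`ξ` — EFFECTIVE in the tree: `isXiPrm_million`, `Literature/IUT/LogVolume/Corollary22PrimeChoiceEffective.lean`). Reader's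
  check: p488306's `¬H₁` re-derived from §3 + §4 (an `example`, no restated declaration).

So the (r2) honest-scope sentence sharpens to: «the `¬H₁` witness is `λ_k` for every `k ≥ max(10⁷, ⌊B/(2·log 7)⌋ + 1)`, `B` the Tate-threshold of
`exists_threshold_P1_to_P6` at (`K_V = CBData.std {2}`, `d = 1`); `H` and Cor. 2.2 (i)'s `C` do not enter; `B` is `∃`-typed through Lemma 5.8.9's
bound and the (P4) ⟹ (P6) height threshold ([GenEll] Lem. 3.5 / Prop. 3.4), `ξ_prm` being effective (`10⁶`)». No print constant is used; nothing here
evaluates `B`. SOURCE locators: [J-IV] Thm. 5.7.1 + «Completion of the proof» p.57 l.17–26, Lemma 5.8.7 p.56 l.33–44, Lemma 5.8.9 / 5.8.11 p.57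
l.1–16, Prop. 6.10.9 p.69 l.1–28, (6.11.1) p.69 l.73–p.70 l.3 (render `HOME/lit/renders/Joshi-arxiv-2403.10430/`); [IUTchIV] Cor. 2.2 (i)–(ii)
pp.41–46, [GenEll] Lem. 3.5 / 3.7 / Prop. 3.4 (kurims). FRAMING (binding): bookkeeping about WHICH constants the located `d = 1` COUNTERMODEL to the
E5 residual AS PRINTED (with (6.11.1)'s `Σ|·|` convention, at OUR typed carriers) depends on — not a statement about any author's theorem; NO side
taken on [IUTchIII] Cor. 3.12 / [IUTchIV] Thm. 1.10, on Joshi's claims or on Mochizuki's report on them; NOT an abc claim (nothing here proves or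
refutes abc); typed ≠ proved ≠ endorsed. Theorems only; standard axioms; no `sorry`, instance, notation, `def` or new `Prop`. FACT rows: none.
[claim: Joshi2024ATS4, status: disputed].
-/

noncomputable section

namespace Summit.ABC.IUTFork.Joshi.ATS4

open NumberField IsDedekindDomain Finset
open Literature.IUT.LogVolume Literature.IUT.LogVolume.Cor22
open Literature.NumberTheory.DiophantineGeometry Literature.NumberTheory.DiophantineGeometry.GenEll
open Literature.NumberTheory.EllipticCurves
open scoped Classical

/-! ## 1. The supplier in THRESHOLD form, parametric in E-t29's `B` — no `Cor22.Hypotheses`, no Cor. 2.2 (i) -/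

/-- **Threshold form of E-t30's `exists_isLem587Prime_lem678Room_offExc`, parametric in the constant `B`** of E-t29's
`exists_threshold_P1_to_P6`: for ANY compactly bounded `Z` (`D : CBData`, no `Cor22.Hypotheses` needed) and `d ≥ 1`, if every
`C_λ ∈ Z ∩ U_{≤d}` with `Tate(C_λ) > B` carries a prime `ℓ ≥ 7` of Lemma 5.8.7 with (P5), (P6), then every `C_λ ∈ Z ∩ U_{≤d}` with
`Tate(C_λ) > B`, `Tate(C_λ) > 12` (so `C_λ` has an `F`-core, `Cor22.logQForall_le_of_not_admitsCore`) and `Tate(C_λ) ≥ (3·log(4·2¹²·3³·5·d))²`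
(the room of Lemma 6.7.8, E-t30's `lem678Room_of_isLem587Prime`) carries `ℓ` with `IsLem587Prime d λ ℓ ∧ ITDConditions λ ℓ ∧ AdmitsCore λ ∧
log(4·2¹²·3³·5·d·ℓ) ≤ (4/3)·ℓ`. The constant `C` of [IUTchIV] Cor. 2.2 (i) does NOT occur (E-t30's proof used it only to phrase the
exceptional set as a HEIGHT bound). PROVED. [claim: Joshi2024ATS4, status: disputed] -/
theorem isLem587Prime_itd_core_room_of_tateThreshold (D : CBData) {d : ℕ} (hd : 0 < d) {B : ℝ}
    (hB : ∀ P ∈ D.toSet ∩ UPle d, B < logQForall P → ∃ ℓ : ℕ, IsLem587Prime d P ℓ ∧ 7 ≤ ℓ ∧ CondP5 P ℓ ∧ CondP6 P ℓ)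
    {P : NFPoint} (hP : P ∈ D.toSet ∩ UPle d) (hBP : B < logQForall P) (h12 : 12 < logQForall P)
    (hR : (3 * Real.log (4 * (2 ^ 12 * 3 ^ 3 * 5 * (d : ℝ)))) ^ 2 ≤ logQForall P) :
    ∃ ℓ : ℕ, IsLem587Prime d P ℓ ∧ ITDConditions P ℓ ∧ AdmitsCore P ∧
      Real.log (4 * (2 ^ 12 * 3 ^ 3 * 5 * (d : ℝ)) * ℓ) ≤ 4 / 3 * ℓ := by
  obtain ⟨ℓ, hℓP, h7, hP5, hP6⟩ := hB P hP hBP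
  have hcore : AdmitsCore P := by
    by_contra hno
    have := logQForall_le_of_not_admitsCore hno
    linarith
  have hdpos : (0 : ℝ) < d := by exact_mod_cast hd
  have hRQ : 3 * Real.log (4 * (2 ^ 12 * 3 ^ 3 * 5 * (d : ℝ))) ≤ Real.sqrt (logQForall P) := Real.le_sqrt_of_sq_le hR
  exact ⟨ℓ, hℓP, ⟨h7, hℓP.2.2.2.1, hP5, hP6⟩, hcore,
    lem678Room_of_isLem587Prime hℓP (C := 2 ^ 12 * 3 ^ 3 * 5 * (d : ℝ)) (by positivity) hRQ⟩

/-- **The same with ONE explicit threshold `T(B, d) = max(max B 12, (3·log(4·2¹²·3³·5·d))²)`** — E-t30's exceptional set IS `{Tate ≤ T}`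
(his proof, verbatim up to the export): above `T`, the prime of Lemma 5.8.7 comes with Thm. 5.7.1's conditions and the room for Lemma 6.7.8.
PROVED. [claim: Joshi2024ATS4, status: disputed] -/
theorem isLem587Prime_itd_core_room_of_lt (D : CBData) {d : ℕ} (hd : 0 < d) {B : ℝ}
    (hB : ∀ P ∈ D.toSet ∩ UPle d, B < logQForall P → ∃ ℓ : ℕ, IsLem587Prime d P ℓ ∧ 7 ≤ ℓ ∧ CondP5 P ℓ ∧ CondP6 P ℓ)
    {P : NFPoint} (hP : P ∈ D.toSet ∩ UPle d)
    (hT : max (max B 12) ((3 * Real.log (4 * (2 ^ 12 * 3 ^ 3 * 5 * (d : ℝ)))) ^ 2) < logQForall P) :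
    ∃ ℓ : ℕ, IsLem587Prime d P ℓ ∧ ITDConditions P ℓ ∧ AdmitsCore P ∧
      Real.log (4 * (2 ^ 12 * 3 ^ 3 * 5 * (d : ℝ)) * ℓ) ≤ 4 / 3 * ℓ :=
  isLem587Prime_itd_core_room_of_tateThreshold D hd hB hP
    (lt_of_le_of_lt ((le_max_left _ _).trans (le_max_left _ _)) hT)
    (lt_of_le_of_lt ((le_max_right _ _).trans (le_max_left _ _)) hT)
    (lt_of_le_of_lt (le_max_right _ _) hT).le

/-- **E-t30's export RECOVERED from the threshold form** (reader's check that nothing was lost): with `B` from E-t29's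
`exists_threshold_P1_to_P6` the exceptional set `{P ∈ Z ∩ U_{≤d} | Tate(P) ≤ T(B, d)}` does the job — and it is only to BOUND ITS HEIGHT
that [IUTchIV] Cor. 2.2 (i) (`Cor22.partI_holds`) is ever needed. PROVED. [claim: Joshi2024ATS4, status: disputed] -/
theorem exists_tateThreshold_isLem587Prime_itd_core_room (D : CBData) (hD : Hypotheses D) {d : ℕ} (hd : 0 < d) :
    ∃ T : ℝ, ∀ P ∈ D.toSet ∩ UPle d, T < logQForall P → ∃ ℓ : ℕ, IsLem587Prime d P ℓ ∧ ITDConditions P ℓ ∧ AdmitsCore P ∧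
      Real.log (4 * (2 ^ 12 * 3 ^ 3 * 5 * (d : ℝ)) * ℓ) ≤ 4 / 3 * ℓ := by
  obtain ⟨B, hB⟩ := exists_threshold_P1_to_P6 D hD hd
  exact ⟨_, fun P hP hT => isLem587Prime_itd_core_room_of_lt D hd hB hP hT⟩

namespace LambdaSevenResidual

/-! ## 2. At `λ_k = 1/2 + 2/7^k` on `K_V = CBData.std {2}`, `d = 1`: the binder's conditions are MET for every `k ≥ 10⁷` with `B < 2k·log 7` -/

/-- `(3·log(4·2¹²·3³·5))² < 2·10⁷·log 7` — so at `d = 1` and `k ≥ 10⁷` the room clause (and `12 <`) of the threshold `T(B, 1)` is automatic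
below `2k·log 7 ≤ log q^∀(λ_k)` (`4·2¹²·3³·5 = 2211840 < 2²²`, `log 2 < 0.6931471808`, `log 7 ≥ 2·log 2`). [folklore] -/
theorem roomConst_sq_lt : (3 * Real.log (4 * (2 ^ 12 * 3 ^ 3 * 5 * ((1 : ℕ) : ℝ)))) ^ 2 < 2 * 10 ^ 7 * Real.log 7 := by
  have h2hi := Real.log_two_lt_d9
  have h2lo := Real.log_two_gt_d9
  simp only [Nat.cast_one, mul_one]
  have hlog : Real.log (4 * (2 ^ 12 * 3 ^ 3 * 5)) ≤ 22 * Real.log 2 := by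
    have h := Real.log_le_log (by norm_num : (0 : ℝ) < 4 * (2 ^ 12 * 3 ^ 3 * 5))
      (by norm_num : (4 * (2 ^ 12 * 3 ^ 3 * 5) : ℝ) ≤ 2 ^ 22)
    rw [Real.log_pow] at h
    push_cast at h
    linarith
  have hlog0 : 0 ≤ Real.log (4 * (2 ^ 12 * 3 ^ 3 * 5) : ℝ) := Real.log_nonneg (by norm_num)
  set L := Real.log (4 * (2 ^ 12 * 3 ^ 3 * 5) : ℝ) with hLdef
  have hL : L < 16 := by linarith
  have hsq : (3 * L) ^ 2 < 2304 := by nlinarith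
  have h7 : 2 * Real.log 2 ≤ Real.log 7 := by
    have h := Real.log_le_log (by norm_num : (0 : ℝ) < 2 ^ 2) (by norm_num : (2 : ℝ) ^ 2 ≤ 7)
    rw [Real.log_pow] at h
    push_cast at h
    linarith
  linarith

/-- **For every `k ≥ 10⁷` with `B < 2k·log 7` the binder's conditions are MET at `λ_k` by a prime `ℓ ≥ 11`**: `λ_k ∈ K_V ∩ U(ℚ̄)_{≤1}`
(`Cor22.ratPoint_lam_mem_std_two`, `ratPoint_mem_UPle_one`), `log q^∀(λ_k) ≥ 2k·log 7 > T(B, 1)` (`Cor22.two_mul_log_seven_le_logQForall_lam`,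
`roomConst_sq_lt`), so §1 supplies `ℓ` with `IsLem587Prime 1 λ_k ℓ ∧ ITDConditions λ_k ℓ ∧ AdmitsCore λ_k ∧ room`, and `ℓ ≥ √(log q^∀) ≥ 11`
(as in p488306). `B` is the ONLY constant; no `H`, no `C`. PROVED. [claim: Joshi2024ATS4, status: disputed] -/
theorem supplied_at_lam (hS : ∀ p ∈ ({2} : Finset ℕ), p.Prime) {B : ℝ}
    (hB : ∀ P ∈ (CBData.std {2} hS).toSet ∩ UPle 1, B < logQForall P →
      ∃ ℓ : ℕ, IsLem587Prime 1 P ℓ ∧ 7 ≤ ℓ ∧ CondP5 P ℓ ∧ CondP6 P ℓ)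
    {k : ℕ} (hk : 10 ^ 7 ≤ k) (hkB : B < 2 * k * Real.log 7) :
    ∃ ℓ : ℕ, IsLem587Prime 1 (ratPoint ((2 : ℚ)⁻¹ + 2 / 7 ^ k)) ℓ ∧ ITDConditions (ratPoint ((2 : ℚ)⁻¹ + 2 / 7 ^ k)) ℓ ∧
      AdmitsCore (ratPoint ((2 : ℚ)⁻¹ + 2 / 7 ^ k)) ∧ Real.log (4 * (2 ^ 12 * 3 ^ 3 * 5 * ((1 : ℕ) : ℝ)) * ℓ) ≤ 4 / 3 * ℓ ∧ 11 ≤ ℓ := by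
  have hk1 : 1 ≤ k := le_trans (by norm_num) hk
  have hk2 : 2 ≤ k := le_trans (by norm_num) hk
  have hkR : (10 : ℝ) ^ 7 ≤ k := by exact_mod_cast hk
  have hlog7 : 0 < Real.log 7 := Real.log_pos (by norm_num)
  have hPD : ratPoint ((2 : ℚ)⁻¹ + 2 / 7 ^ k) ∈ (CBData.std {2} hS).toSet := ratPoint_lam_mem_std_two hk2 hS
  have hP1 : ratPoint ((2 : ℚ)⁻¹ + 2 / 7 ^ k) ∈ UPle 1 := ratPoint_mem_UPle_one (lamSeven_ne hk1).1 (lamSeven_ne hk1).2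
  have hQlow : 2 * (k : ℝ) * Real.log 7 ≤ logQForall (ratPoint ((2 : ℚ)⁻¹ + 2 / 7 ^ k)) :=
    two_mul_log_seven_le_logQForall_lam hk1
  -- the threshold `T(B, 1) = max(max B 12, R₁²)` lies below `2k·log 7 ≤ log q^∀(λ_k)`
  have hroom := roomConst_sq_lt
  have h2k : 2 * 10 ^ 7 * Real.log 7 ≤ 2 * (k : ℝ) * Real.log 7 := by nlinarith
  have hlog27 : 2 * Real.log 2 ≤ Real.log 7 := by
    have h := Real.log_le_log (by norm_num : (0 : ℝ) < 2 ^ 2) (by norm_num : (2 : ℝ) ^ 2 ≤ 7)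
    rw [Real.log_pow] at h
    push_cast at h
    linarith
  have h121 : (121 : ℝ) < 2 * (k : ℝ) * Real.log 7 := by
    have := Real.log_two_gt_d9
    nlinarith
  have hT : max (max B 12) ((3 * Real.log (4 * (2 ^ 12 * 3 ^ 3 * 5 * ((1 : ℕ) : ℝ)))) ^ 2) <
      logQForall (ratPoint ((2 : ℚ)⁻¹ + 2 / 7 ^ k)) :=
    max_lt (max_lt (lt_of_lt_of_le hkB hQlow) (lt_of_lt_of_le (by linarith) hQlow))
      (lt_of_lt_of_le hroom (h2k.trans hQlow))
  obtain ⟨ℓ, hℓP, hITD, hcore, hroom'⟩ := isLem587Prime_itd_core_room_of_lt (CBData.std {2} hS) one_pos hB ⟨hPD, hP1⟩ hT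
  -- `ℓ ≥ √(log q^∀(λ_k)) ≥ 11`
  have h11 : 11 ≤ ℓ := by
    have hs : Real.sqrt (logQForall (ratPoint ((2 : ℚ)⁻¹ + 2 / 7 ^ k))) ≤ ℓ := hℓP.2.1
    have h11s : (11 : ℝ) ≤ Real.sqrt (logQForall (ratPoint ((2 : ℚ)⁻¹ + 2 / 7 ^ k))) :=
      Real.le_sqrt_of_sq_le (by nlinarith)
    exact_mod_cast h11s.trans hs
  exact ⟨ℓ, hℓP, hITD, hcore, hroom', h11⟩

/-! ## 3. EFFECTIVE pointwise `¬H₁`: the `∀ℓ`-clause of the `d = 1` binder AT THE POINT `λ_k` is false, for every `k ≥ k₀(B)` -/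

/-- **The `∀ℓ`-clause of `H₁` AT `P := λ_k` (VERBATIM from p488306's `not_genuineResidualSupport_antecedent_degOne`, the outer `∀ P ∈ UPle 1`
instantiated) is FALSE for EVERY `k ≥ 10⁷` with `B < 2k·log 7`**, `B` any constant with E-t29's (P1)–(P6) threshold property on
`K_V = CBData.std {2}` at `d = 1`: §2 supplies `ℓ ≥ 11` meeting all four conditions, and E-t35's uniform `genuineResidualSupport_unsat` (every
`k ≥ 10⁷`, every prime `ℓ ≥ 11`) refutes the `∃`-body. Neither the height bound `H` of an exceptional set nor [IUTchIV] Cor. 2.2 (i)'s constant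
`C` occurs. A located COUNTERMODEL to the E5 residual AS PRINTED ((6.11.1)'s `Σ|·|` convention) at OUR typed carriers — not to any author's theorem;
NO side taken on [IUTchIII] Cor. 3.12 / [IUTchIV] Thm. 1.10; NOT an abc claim. [claim: Joshi2024ATS4, status: disputed] -/
theorem not_antecedent_degOne_at_lam (hS : ∀ p ∈ ({2} : Finset ℕ), p.Prime) {B : ℝ}
    (hB : ∀ P ∈ (CBData.std {2} hS).toSet ∩ UPle 1, B < logQForall P →
      ∃ ℓ : ℕ, IsLem587Prime 1 P ℓ ∧ 7 ≤ ℓ ∧ CondP5 P ℓ ∧ CondP6 P ℓ)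
    {k : ℕ} (hk : 10 ^ 7 ≤ k) (hkB : B < 2 * k * Real.log 7) :
    ¬ (∀ (ℓ : ℕ) (_ : ℓ.Prime) (_ : 5 ≤ ℓ), IsLem587Prime 1 (ratPoint ((2 : ℚ)⁻¹ + 2 / 7 ^ k)) ℓ →
      ITDConditions (ratPoint ((2 : ℚ)⁻¹ + 2 / 7 ^ k)) ℓ → AdmitsCore (ratPoint ((2 : ℚ)⁻¹ + 2 / 7 ^ k)) →
      Real.log (4 * (2 ^ 12 * 3 ^ 3 * 5 * ((1 : ℕ) : ℝ)) * ℓ) ≤ 4 / 3 * ℓ →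
        ∃ (F : Type) (_ : Field F) (_ : NumberField F) (_ : Algebra (ratPoint ((2 : ℚ)⁻¹ + 2 / 7 ^ k)).F F)
          (K : Type) (_ : Field K) (_ : NumberField K) (_ : Algebra F K) (_ : Algebra (ratPoint ((2 : ℚ)⁻¹ + 2 / 7 ^ k)).F K)
          (_ : IsScalarTower (ratPoint ((2 : ℚ)⁻¹ + 2 / 7 ^ k)).F F K)
          (_ : IsGalois F K) (ψ : K →ₐ[F] AlgebraicClosure F) (hU : (ratPoint ((2 : ℚ)⁻¹ + 2 / 7 ^ k)).InU)
          (_ : IsThetaField (ratPoint ((2 : ℚ)⁻¹ + 2 / 7 ^ k)) F)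
          (_ : letI := thetaCurve_isElliptic hU F
            ((thetaCurve (ratPoint ((2 : ℚ)⁻¹ + 2 / 7 ^ k)) F).galoisRepTorsion (ℓ : ℤ)).ker ≤ ψ.fieldRange.fixingSubgroup)
          (_ : 0 < (TateDivisorDatum.ofNFPointOver (ratPoint ((2 : ℚ)⁻¹ + 2 / 7 ^ k)) {2, ℓ} F).logq)
          (Lmod : Type) (_ : Field Lmod) (_ : NumberField Lmod) (_ : Cor22.dmod (ratPoint ((2 : ℚ)⁻¹ + 2 / 7 ^ k)) ≤ dMod Lmod)
          (_ : dMod Lmod ≤ 1)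
          (V : Finset ℕ)
          (_ : ∀ q ∈ V, q.Prime ∧ (q ∣ 2 * 3 * 5 * ℓ ∨
            (∃ v ∈ badPlacesAvoid (ratPoint ((2 : ℚ)⁻¹ + 2 / 7 ^ k)) {2, ℓ}, residueChar (ratPoint ((2 : ℚ)⁻¹ + 2 / 7 ^ k)).F v = q) ∨
            ∃ u : HeightOneSpectrum (𝓞 K), residueChar K u = q ∧ 2 ≤ u.asIdeal.ramificationIdx ℤ))
          (_ : ∀ u : HeightOneSpectrum (𝓞 K), 2 ≤ u.asIdeal.ramificationIdx ℤ → residueChar K u ∈ V)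
          (_ : ∀ w ∈ (TateDivisorDatum.ofNFPointOver (ratPoint ((2 : ℚ)⁻¹ + 2 / 7 ^ k)) {2, ℓ} F).V, residueChar F w ∈ V)
          (DK : Finset (HeightOneSpectrum (𝓞 K))) (_ : ∀ u, differentDivisor K (Sum.inr u) ≠ 0 → u ∈ DK)
          (vol : ℕ → ℝ) (volArch : ℝ),
          (∀ p ∈ V, -(1 / (((ℓ : ℝ) - 1) / 2)) * |vol p| ≤ ((ℓ : ℝ) + 1) / 4 *
            ((1 + 4 / (ℓ : ℝ)) *
                ((Module.finrank ℚ K : ℝ)⁻¹ *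
                  ∑ u ∈ DK with residueChar K u = p, differentDivisor K (Sum.inr u) * logNorm K u)
              - 1 / 6 *
                ((Module.finrank ℚ F : ℝ)⁻¹ *
                  ∑ w ∈ (TateDivisorDatum.ofNFPointOver (ratPoint ((2 : ℚ)⁻¹ + 2 / 7 ^ k)) {2, ℓ} F).V with residueChar F w = p,
                    (TateDivisorDatum.ofNFPointOver (ratPoint ((2 : ℚ)⁻¹ + 2 / 7 ^ k)) {2, ℓ} F).tateDivisor (Sum.inr w) * logNorm F w)
              + 4 / (ℓ : ℝ) * Real.log p
              + 20 / 3 * ((2 ^ 12 * 3 ^ 3 * 5 * eMod Lmod : ℕ) : ℝ) *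
                (if p ≤ 2 ^ 12 * 3 ^ 3 * 5 * eMod Lmod * ℓ then Real.log p / p else 0))) ∧
          -(1 / (2 * (ℓ : ℝ)) * (TateDivisorDatum.ofNFPointOver (ratPoint ((2 : ℚ)⁻¹ + 2 / 7 ^ k)) {2, ℓ} F).logq) ≤
            -(1 / (((ℓ : ℝ) - 1) / 2)) * (∑ p ∈ V, |vol p| + |volArch|)) := by
  intro h
  obtain ⟨ℓ, hℓP, hITD, hcore, hroom, h11⟩ := supplied_at_lam hS hB hk hkB
  exact genuineResidualSupport_unsat hk hℓP.1 h11 (h ℓ hℓP.1 (by omega) hℓP hITD hcore hroom)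

/-- **`k₀(B) := max(10⁷, ⌊B/(2·log 7)⌋₊ + 1)` does it**: a CLOSED TERM in the one real parameter `B` with `k₀ ≥ 10⁷` and `B < 2·k₀·log 7`
(indeed for every `k ≥ k₀`). [folklore] -/
theorem kZero_spec (B : ℝ) {k : ℕ} (hk : max (10 ^ 7) (⌊B / (2 * Real.log 7)⌋₊ + 1) ≤ k) :
    10 ^ 7 ≤ k ∧ B < 2 * k * Real.log 7 := by
  refine ⟨(le_max_left _ _).trans hk, ?_⟩
  have hlog7 : 0 < Real.log 7 := Real.log_pos (by norm_num)
  have hfl : ⌊B / (2 * Real.log 7)⌋₊ + 1 ≤ k := (le_max_right _ _).trans hk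
  have hlt : B / (2 * Real.log 7) < (⌊B / (2 * Real.log 7)⌋₊ + 1 : ℕ) := by
    push_cast
    exact Nat.lt_floor_add_one _
  have hkR : ((⌊B / (2 * Real.log 7)⌋₊ + 1 : ℕ) : ℝ) ≤ k := by exact_mod_cast hfl
  have := (div_lt_iff₀ (by positivity : (0 : ℝ) < 2 * Real.log 7)).mp (lt_of_lt_of_le hlt hkR)
  linarith

/-- **EFFECTIVE `¬H₁` AT `λ_k` FOR EVERY `k ≥ k₀(B) = max(10⁷, ⌊B/(2·log 7)⌋₊ + 1)`** — row R-35's KEEP form: the witness index is an EXPLICIT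
function of the one typed constant `B` (E-t29's Tate-threshold at `K_V = CBData.std {2}`, `d = 1`); `H` and `C` are gone. PROVED.
[claim: Joshi2024ATS4, status: disputed] -/
theorem not_antecedent_degOne_at_lam_of_kZero_le (hS : ∀ p ∈ ({2} : Finset ℕ), p.Prime) {B : ℝ}
    (hB : ∀ P ∈ (CBData.std {2} hS).toSet ∩ UPle 1, B < logQForall P →
      ∃ ℓ : ℕ, IsLem587Prime 1 P ℓ ∧ 7 ≤ ℓ ∧ CondP5 P ℓ ∧ CondP6 P ℓ)
    {k : ℕ} (hk : max (10 ^ 7) (⌊B / (2 * Real.log 7)⌋₊ + 1) ≤ k) :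
    ¬ (∀ (ℓ : ℕ) (_ : ℓ.Prime) (_ : 5 ≤ ℓ), IsLem587Prime 1 (ratPoint ((2 : ℚ)⁻¹ + 2 / 7 ^ k)) ℓ →
      ITDConditions (ratPoint ((2 : ℚ)⁻¹ + 2 / 7 ^ k)) ℓ → AdmitsCore (ratPoint ((2 : ℚ)⁻¹ + 2 / 7 ^ k)) →
      Real.log (4 * (2 ^ 12 * 3 ^ 3 * 5 * ((1 : ℕ) : ℝ)) * ℓ) ≤ 4 / 3 * ℓ →
        ∃ (F : Type) (_ : Field F) (_ : NumberField F) (_ : Algebra (ratPoint ((2 : ℚ)⁻¹ + 2 / 7 ^ k)).F F)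
          (K : Type) (_ : Field K) (_ : NumberField K) (_ : Algebra F K) (_ : Algebra (ratPoint ((2 : ℚ)⁻¹ + 2 / 7 ^ k)).F K)
          (_ : IsScalarTower (ratPoint ((2 : ℚ)⁻¹ + 2 / 7 ^ k)).F F K)
          (_ : IsGalois F K) (ψ : K →ₐ[F] AlgebraicClosure F) (hU : (ratPoint ((2 : ℚ)⁻¹ + 2 / 7 ^ k)).InU)
          (_ : IsThetaField (ratPoint ((2 : ℚ)⁻¹ + 2 / 7 ^ k)) F)
          (_ : letI := thetaCurve_isElliptic hU F
            ((thetaCurve (ratPoint ((2 : ℚ)⁻¹ + 2 / 7 ^ k)) F).galoisRepTorsion (ℓ : ℤ)).ker ≤ ψ.fieldRange.fixingSubgroup)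
          (_ : 0 < (TateDivisorDatum.ofNFPointOver (ratPoint ((2 : ℚ)⁻¹ + 2 / 7 ^ k)) {2, ℓ} F).logq)
          (Lmod : Type) (_ : Field Lmod) (_ : NumberField Lmod) (_ : Cor22.dmod (ratPoint ((2 : ℚ)⁻¹ + 2 / 7 ^ k)) ≤ dMod Lmod)
          (_ : dMod Lmod ≤ 1)
          (V : Finset ℕ)
          (_ : ∀ q ∈ V, q.Prime ∧ (q ∣ 2 * 3 * 5 * ℓ ∨
            (∃ v ∈ badPlacesAvoid (ratPoint ((2 : ℚ)⁻¹ + 2 / 7 ^ k)) {2, ℓ}, residueChar (ratPoint ((2 : ℚ)⁻¹ + 2 / 7 ^ k)).F v = q) ∨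
            ∃ u : HeightOneSpectrum (𝓞 K), residueChar K u = q ∧ 2 ≤ u.asIdeal.ramificationIdx ℤ))
          (_ : ∀ u : HeightOneSpectrum (𝓞 K), 2 ≤ u.asIdeal.ramificationIdx ℤ → residueChar K u ∈ V)
          (_ : ∀ w ∈ (TateDivisorDatum.ofNFPointOver (ratPoint ((2 : ℚ)⁻¹ + 2 / 7 ^ k)) {2, ℓ} F).V, residueChar F w ∈ V)
          (DK : Finset (HeightOneSpectrum (𝓞 K))) (_ : ∀ u, differentDivisor K (Sum.inr u) ≠ 0 → u ∈ DK)
          (vol : ℕ → ℝ) (volArch : ℝ),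
          (∀ p ∈ V, -(1 / (((ℓ : ℝ) - 1) / 2)) * |vol p| ≤ ((ℓ : ℝ) + 1) / 4 *
            ((1 + 4 / (ℓ : ℝ)) *
                ((Module.finrank ℚ K : ℝ)⁻¹ *
                  ∑ u ∈ DK with residueChar K u = p, differentDivisor K (Sum.inr u) * logNorm K u)
              - 1 / 6 *
                ((Module.finrank ℚ F : ℝ)⁻¹ *
                  ∑ w ∈ (TateDivisorDatum.ofNFPointOver (ratPoint ((2 : ℚ)⁻¹ + 2 / 7 ^ k)) {2, ℓ} F).V with residueChar F w = p,
                    (TateDivisorDatum.ofNFPointOver (ratPoint ((2 : ℚ)⁻¹ + 2 / 7 ^ k)) {2, ℓ} F).tateDivisor (Sum.inr w) * logNorm F w)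
              + 4 / (ℓ : ℝ) * Real.log p
              + 20 / 3 * ((2 ^ 12 * 3 ^ 3 * 5 * eMod Lmod : ℕ) : ℝ) *
                (if p ≤ 2 ^ 12 * 3 ^ 3 * 5 * eMod Lmod * ℓ then Real.log p / p else 0))) ∧
          -(1 / (2 * (ℓ : ℝ)) * (TateDivisorDatum.ofNFPointOver (ratPoint ((2 : ℚ)⁻¹ + 2 / 7 ^ k)) {2, ℓ} F).logq) ≤
            -(1 / (((ℓ : ℝ) - 1) / 2)) * (∑ p ∈ V, |vol p| + |volArch|)) :=
  not_antecedent_degOne_at_lam hS hB (kZero_spec B hk).1 (kZero_spec B hk).2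

end LambdaSevenResidual

/-! ## 4. LOCATION of the one remaining `∃`: E-t29's `B` at (`CBData.std {2}`, `d = 1`); reader's check — p488306's `¬H₁` from §3 -/

/-- **The typed constant binder of row R-35, located**: `B` is E-t29's `exists_threshold_P1_to_P6` at `K_V = CBData.std {2}` (`Cor22.hypotheses_std`)
and `d = 1` — in whose proof `B = max(max B′ 49, max H_K ξ²)` with `B′` from `lem589_holds` (Lemma 5.8.9; the BD-constant of `Cor22.partI_first`),
`H_K` from `Cor22.condP6_of_seven_le` ((P4) ⟹ (P6): `exists_jInv_bound`, [GenEll] Lem. 3.5 / Prop. 3.4 constants `GenEll_lemma35_general` /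
`prop34Ineq_of_pos`) and `ξ` from `exists_isXiPrm` (EFFECTIVE in the tree: `isXiPrm_million`). This `∃` is where the (r2) countermodel's witness
index stops being a numeral; nothing here evaluates it. [claim: Joshi2024ATS4, status: disputed] -/
theorem exists_tateThreshold_std_two_degOne (hS : ∀ p ∈ ({2} : Finset ℕ), p.Prime) :
    ∃ B : ℝ, ∀ P ∈ (CBData.std {2} hS).toSet ∩ UPle 1, B < logQForall P →
      ∃ ℓ : ℕ, IsLem587Prime 1 P ℓ ∧ 7 ≤ ℓ ∧ CondP5 P ℓ ∧ CondP6 P ℓ :=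
  exists_threshold_P1_to_P6 (CBData.std {2} hS) (hypotheses_std {2} hS (by simp)) le_rfl

/-- Reader's check: p488306's `not_genuineResidualSupport_antecedent_degOne` (`¬H₁`, statement VERBATIM) FOLLOWS from the effective §3 at
`k := k₀(B)` with `B` of §4 — so the only non-closed ingredient of the (r2) witness is that `B`. (An `example`: the negated statement is E-t35's
declaration and is not re-declared.) [claim: Joshi2024ATS4, status: disputed] -/
example : ¬ (∀ P ∈ UPle 1, ∀ (ℓ : ℕ) (hℓ : ℓ.Prime) (h5 : 5 ≤ ℓ), IsLem587Prime 1 P ℓ → ITDConditions P ℓ →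
      AdmitsCore P → Real.log (4 * (2 ^ 12 * 3 ^ 3 * 5 * ((1 : ℕ) : ℝ)) * ℓ) ≤ 4 / 3 * ℓ →
        ∃ (F : Type) (_ : Field F) (_ : NumberField F) (_ : Algebra P.F F)
          (K : Type) (_ : Field K) (_ : NumberField K) (_ : Algebra F K) (_ : Algebra P.F K) (_ : IsScalarTower P.F F K)
          (_ : IsGalois F K) (ψ : K →ₐ[F] AlgebraicClosure F) (hU : P.InU) (_ : IsThetaField P F)
          (_ : letI := thetaCurve_isElliptic hU F
            ((thetaCurve P F).galoisRepTorsion (ℓ : ℤ)).ker ≤ ψ.fieldRange.fixingSubgroup)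
          (_ : 0 < (TateDivisorDatum.ofNFPointOver P {2, ℓ} F).logq)
          (Lmod : Type) (_ : Field Lmod) (_ : NumberField Lmod) (_ : Cor22.dmod P ≤ dMod Lmod) (_ : dMod Lmod ≤ 1)
          (V : Finset ℕ)
          (_ : ∀ q ∈ V, q.Prime ∧ (q ∣ 2 * 3 * 5 * ℓ ∨ (∃ v ∈ badPlacesAvoid P {2, ℓ}, residueChar P.F v = q) ∨
            ∃ u : HeightOneSpectrum (𝓞 K), residueChar K u = q ∧ 2 ≤ u.asIdeal.ramificationIdx ℤ))
          (_ : ∀ u : HeightOneSpectrum (𝓞 K), 2 ≤ u.asIdeal.ramificationIdx ℤ → residueChar K u ∈ V)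
          (_ : ∀ w ∈ (TateDivisorDatum.ofNFPointOver P {2, ℓ} F).V, residueChar F w ∈ V)
          (DK : Finset (HeightOneSpectrum (𝓞 K))) (_ : ∀ u, differentDivisor K (Sum.inr u) ≠ 0 → u ∈ DK)
          (vol : ℕ → ℝ) (volArch : ℝ),
          (∀ p ∈ V, -(1 / (((ℓ : ℝ) - 1) / 2)) * |vol p| ≤ ((ℓ : ℝ) + 1) / 4 *
            ((1 + 4 / (ℓ : ℝ)) *
                ((Module.finrank ℚ K : ℝ)⁻¹ *
                  ∑ u ∈ DK with residueChar K u = p, differentDivisor K (Sum.inr u) * logNorm K u)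
              - 1 / 6 *
                ((Module.finrank ℚ F : ℝ)⁻¹ *
                  ∑ w ∈ (TateDivisorDatum.ofNFPointOver P {2, ℓ} F).V with residueChar F w = p,
                    (TateDivisorDatum.ofNFPointOver P {2, ℓ} F).tateDivisor (Sum.inr w) * logNorm F w)
              + 4 / (ℓ : ℝ) * Real.log p
              + 20 / 3 * ((2 ^ 12 * 3 ^ 3 * 5 * eMod Lmod : ℕ) : ℝ) *
                (if p ≤ 2 ^ 12 * 3 ^ 3 * 5 * eMod Lmod * ℓ then Real.log p / p else 0))) ∧
          -(1 / (2 * (ℓ : ℝ)) * (TateDivisorDatum.ofNFPointOver P {2, ℓ} F).logq) ≤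
            -(1 / (((ℓ : ℝ) - 1) / 2)) * (∑ p ∈ V, |vol p| + |volArch|)) := by
  intro h
  have hS : ∀ p ∈ ({2} : Finset ℕ), p.Prime := by simp [Nat.prime_two]
  obtain ⟨B, hB⟩ := exists_tateThreshold_std_two_degOne hS
  -- the EXPLICIT index `k₀(B)`
  have hk1 : 1 ≤ max (10 ^ 7) (⌊B / (2 * Real.log 7)⌋₊ + 1) := le_trans (by norm_num) (le_max_left _ _)
  exact LambdaSevenResidual.not_antecedent_degOne_at_lam_of_kZero_le hS hB le_rfl
    (h _ (ratPoint_mem_UPle_one (lamSeven_ne hk1).1 (lamSeven_ne hk1).2))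

/-- … and the statement just checked IS p488306's theorem (by name), so both proofs refute the same `H₁`. -/
example := @not_genuineResidualSupport_antecedent_degOne

end Summit.ABC.IUTFork.Joshi.ATS4

end
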